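import Summits.Ventures.LatticeQCDFlow.TrivializingMaps.AnnealingAnyGroup

/-!
HONEST FRAMING: exact (Metropolis-corrected) sampling algorithms for lattice gauge theory; figures
of merit are autocorrelation/cost numbers at stated couplings and volumes; no continuum-physics
claim.

# ReweightingWindowsStrongCoupling — WITH AN `O(1)` WEIGHT-VARIANCE BUDGET PER STEP, CROSSING A
# STRONG-COUPLING WINDOW TAKES `Θ(√#plaq)` EXACT REWEIGHTING STEPS: NECESSARY FOR EVERY SCHEDULE,
# SUFFICIENT FOR THE UNIFORM ONE, EVERY COMPACT GAUGE GROUP (lean-2 GEN-10, ours)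

Venture-side (OURS).  Cell `lqcd-flow` (pub-lqcd), unit `pub-lqcd-lean-2-g10`, 2026-08-23.  Setting of
`ReweightingStepLawAnyGroup` / `AnnealingAnyGroup` (GEN-8): `G` compact second countable, `ρ` continuous
(unitary in §2), `S_W^ρ` the Wilson action on `(ℤ/L)^d`, `μ_t = wilsonMeasure ρ t`, `ψ = cgf(−S_W^ρ)`,
one exact reweighting step `β → β+δ` has `log E_{μ_β}[w²] = Δ²ψ(β; δ) = ψ(β+2δ) − 2ψ(β+δ) + ψ(β)
= ∫_β^{β+δ}∫_t^{t+δ} Var`.  The practitioner's criterion is a PER-STEP window: every step must keep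
`log E[w_j²] ≤ t₀` (an `O(1)` effective-sample-size loss per step).  This file counts the steps needed to
cross a coupling interval `[a, b]` under that criterion.

* §1 (abstract, every compact `G`, every continuous `ρ`):
  **`stepCost_le_of_ceiling`** — a ceiling `Var_u ≤ M` on `[β, β+2δ]` and `δ²M ≤ t₀` give `Δ²ψ(β;δ) ≤ t₀`;
  **`uniform_window_sufficient`** — a ceiling `M` on `[a, a+(k+1)δ]` and `δ²M ≤ t₀` make EVERY step of
  the uniform schedule `β_j = a + jδ` admissible;
  **`window_steps_necessary`** — a floor `0 ≤ m ≤ Var_u` along a schedule `β_{i+1} = β_i + δ_i`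
  (`0 ≤ δ_i ≤ D`, `[β_0, β_k + D]` inside the floor region) whose every step has `Δ²ψ ≤ t₀` forces
  **`m·(β_k − β_0)² ≤ k²·t₀`** (per step `δ_i²m ≤ t₀`, then Cauchy–Schwarz): `k ≥ (β_k−β_0)·√(m/t₀)`.
* §2 (strong coupling, unitary `ρ`, `L ≥ 2`, `r = 1/(4e·max(1,2N)·(3^d d²+1)²)`, `v_ρ = Var_Haar(Re tr ρ)`,
  floor `v_ρ·#plaq/2` on `|u| ≤ w := min(r/8, v_ρ r³/512)` and ceiling `32·#plaq/r²` on `|u| < r/2`,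
  both GEN-8, `SpecificHeatAnyGroup`):
  **`wilson_window_steps_necessary_strongCoupling`** — every schedule inside `[−w, w]` with per-step
  budget `t₀` has `(v_ρ·#plaq/2)·(β_k − β_0)² ≤ k²·t₀`;
  **`wilson_uniform_window_sufficient_strongCoupling`** — the uniform schedule with
  `δ²·(32·#plaq/r²) ≤ t₀` inside `[−r/4, r/4]` meets the budget at every step.
  READING: to cross `[a, b]` inside the window with `log E[w_j²] ≤ t₀` per step one needs
  `k ≥ (b−a)·√(v_ρ·#plaq/(2t₀))` steps (any schedule) and `k = ⌈(b−a)·√(32·#plaq/t₀)/r⌉` uniform steps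
  suffice: **`Θ(√volume)` `O(1)`-windows**, every compact gauge group, closed-form (poor) constants.

NOT CLAIMED: anything outside the strong-coupling window (at larger couplings only the necessity side
is in the tree: GEN-9 `WilsonVarianceFloorAllCouplings`, theory2's (SH_W) for `SU(n)`; a pointwise
variance CEILING is not available there); finite-sample ESS; optimal schedules; cost / autocorrelation /
continuum statements.  Literature grade (cell rule): elementary; new typing.
-/

noncomputable section

open MeasureTheory ProbabilityTheory Set
open Literature.MathematicalPhysics.QuantumFieldTheory
open Literature.MathematicalPhysics.QuantumFieldTheory.Luscher2010
open scoped Matrix Matrix.Norms.Frobenius ContDiff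

namespace Summit.Ventures.LatticeQCDFlow.TrivializingMaps

/-! ## §1 Abstract window counts, every compact gauge group -/

section AnyGroup

variable {d L N : ℕ} [NeZero L] {G : Type*} [Group G] [TopologicalSpace G] [IsTopologicalGroup G]
  [CompactSpace G] [MeasurableSpace G] [BorelSpace G] [SecondCountableTopology G]
  (ρ : G →* Matrix (Fin N) (Fin N) ℂ)

/-- **One admissible step from a variance ceiling**: `Var_u(S_W^ρ) ≤ M` on `[β, β+2δ]`, `δ ≥ 0` and
`δ²·M ≤ t₀` give `Δ²ψ(β; δ) ≤ t₀`. [ours] -/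
theorem stepCost_le_of_ceiling (hρ : Continuous ρ) {β δ M t₀ : ℝ} (hδ : 0 ≤ δ)
    (hM : ∀ u ∈ Icc β (β + 2 * δ), variance (wilsonAction (d := d) (L := L) ρ)
      (wilsonMeasure (d := d) (L := L) ρ u) ≤ M) (hδM : δ ^ 2 * M ≤ t₀) :
    cgf (fun U => -wilsonAction ρ U) (trivialMeasure G d L) (β + 2 * δ) -
        2 * cgf (fun U => -wilsonAction ρ U) (trivialMeasure G d L) (β + δ) +
        cgf (fun U => -wilsonAction ρ U) (trivialMeasure G d L) β ≤ t₀ :=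
  (cgf_second_difference_le_anyGroup (d := d) (L := L) hρ hδ hM).trans hδM

/-- **The uniform schedule is admissible at every step** under a ceiling `M` on `[a, a+(k+1)δ]` with
`δ²·M ≤ t₀` (`δ ≥ 0`). [ours] -/
theorem uniform_window_sufficient (hρ : Continuous ρ) {a δ M t₀ : ℝ} (hδ : 0 ≤ δ) {k : ℕ}
    (hM : ∀ u ∈ Icc a (a + (k + 1) * δ), variance (wilsonAction (d := d) (L := L) ρ)
      (wilsonMeasure (d := d) (L := L) ρ u) ≤ M) (hδM : δ ^ 2 * M ≤ t₀) :
    ∀ j < k,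
      cgf (fun U => -wilsonAction ρ U) (trivialMeasure G d L) (a + j * δ + 2 * δ) -
        2 * cgf (fun U => -wilsonAction ρ U) (trivialMeasure G d L) (a + j * δ + δ) +
        cgf (fun U => -wilsonAction ρ U) (trivialMeasure G d L) (a + j * δ) ≤ t₀ := by
  intro j hj
  refine stepCost_le_of_ceiling (d := d) (L := L) ρ hρ hδ (fun u hu => hM u ?_) hδM
  have hj' : (j : ℝ) + 1 ≤ k := by exact_mod_cast Nat.succ_le_of_lt hj
  constructor
  · have : 0 ≤ (j : ℝ) * δ := by positivity
    linarith [hu.1]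
  · have : (j : ℝ) * δ + 2 * δ ≤ (k + 1) * δ := by nlinarith
    linarith [hu.2]

/-- **NECESSITY UNDER A PER-STEP BUDGET**: along a schedule `β_{i+1} = β_i + δ_i` (`0 ≤ δ_i ≤ D`, `k`
steps) with a floor `0 ≤ m ≤ Var_u(S_W^ρ)` on `[β_0, β_k + D]`, if every step has `Δ²ψ(β_i; δ_i) ≤ t₀`
then **`m·(β_k − β_0)² ≤ k²·t₀`**, i.e. `k ≥ (β_k − β_0)·√(m/t₀)`. [ours] -/
theorem window_steps_necessary (hρ : Continuous ρ) (k : ℕ) (β δ : ℕ → ℝ)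
    (hstep : ∀ i, β (i + 1) = β i + δ i) (hδ : ∀ i < k, 0 ≤ δ i) {D m t₀ : ℝ}
    (hD : ∀ i < k, δ i ≤ D) (hm0 : 0 ≤ m)
    (hm : ∀ u ∈ Icc (β 0) (β k + D), m ≤ variance (wilsonAction (d := d) (L := L) ρ)
      (wilsonMeasure (d := d) (L := L) ρ u))
    (hcost : ∀ i < k,
      cgf (fun U => -wilsonAction ρ U) (trivialMeasure G d L) (β i + 2 * δ i) -
        2 * cgf (fun U => -wilsonAction ρ U) (trivialMeasure G d L) (β i + δ i) +
        cgf (fun U => -wilsonAction ρ U) (trivialMeasure G d L) (β i) ≤ t₀) :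
    m * (β k - β 0) ^ 2 ≤ (k : ℝ) ^ 2 * t₀ := by
  -- monotone couplings
  have hsum : ∀ j, β j = β 0 + ∑ i ∈ Finset.range j, δ i := by
    intro j
    induction j with
    | zero => simp
    | succ j ih => rw [hstep, ih, Finset.sum_range_succ]; ring
  have hmono : ∀ j ≤ k, ∀ i ≤ j, β i ≤ β j := by
    intro j hj i hij
    rw [hsum i, hsum j, add_le_add_iff_left]
    exact Finset.sum_le_sum_of_subset_of_nonneg (Finset.range_subset_range.2 hij)
      fun l hl _ => hδ l (lt_of_lt_of_le (Finset.mem_range.1 hl) hj)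
  -- per step: `δ_i² m ≤ Δ²ψ_i ≤ t₀`
  have hper : ∀ i < k, δ i ^ 2 * m ≤ t₀ := by
    intro i hi
    refine le_trans (cgf_second_difference_ge_anyGroup (d := d) (L := L) hρ (hδ i hi) ?_) (hcost i hi)
    intro u hu
    refine hm u ⟨?_, ?_⟩
    · exact (hmono i hi.le 0 (Nat.zero_le i)).trans hu.1
    · have h2 : β (i + 1) ≤ β k := hmono k le_rfl (i + 1) hi
      have h3 : β i + δ i = β (i + 1) := (hstep i).symm
      linarith [hu.2, hD i hi]
  have hsumsq : (∑ i ∈ Finset.range k, δ i ^ 2) * m ≤ k * t₀ := by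
    rw [Finset.sum_mul]
    calc ∑ i ∈ Finset.range k, δ i ^ 2 * m ≤ ∑ _i ∈ Finset.range k, t₀ :=
          Finset.sum_le_sum fun i hi => hper i (Finset.mem_range.1 hi)
      _ = k * t₀ := by rw [Finset.sum_const, Finset.card_range, nsmul_eq_mul]
  -- Cauchy–Schwarz: `(Σ δ_i)² ≤ k · Σ δ_i²`
  have hcs := Finset.sum_mul_sq_le_sq_mul_sq (Finset.range k) (fun _ => (1 : ℝ)) (fun i => δ i)
  simp only [one_mul, one_pow, Finset.sum_const, Finset.card_range, nsmul_eq_mul, mul_one] at hcs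
  have hΔ : β k - β 0 = ∑ i ∈ Finset.range k, δ i := by rw [hsum k]; ring
  rw [hΔ]
  calc m * (∑ i ∈ Finset.range k, δ i) ^ 2 ≤ m * (k * ∑ i ∈ Finset.range k, δ i ^ 2) :=
        mul_le_mul_of_nonneg_left hcs hm0
    _ = k * ((∑ i ∈ Finset.range k, δ i ^ 2) * m) := by ring
    _ ≤ k * (k * t₀) := mul_le_mul_of_nonneg_left hsumsq (Nat.cast_nonneg _)
    _ = (k : ℝ) ^ 2 * t₀ := by ring

end AnyGroup

/-! ## §2 Strong coupling, every compact gauge group: `Θ(√#plaq)` windows -/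

section StrongCoupling

variable {d L N : ℕ} [NeZero L] {G : Type*} [Group G] [TopologicalSpace G] [IsTopologicalGroup G]
  [CompactSpace G] [MeasurableSpace G] [BorelSpace G] [SecondCountableTopology G]
  (ρ : G →* Matrix (Fin N) (Fin N) ℂ)

/-- **NECESSITY AT STRONG COUPLING, EVERY COMPACT GAUGE GROUP**: a schedule `β_{i+1} = β_i + δ_i`
(`0 ≤ δ_i ≤ D`) inside the window `[−w, w]`, `w = min(r/8, v_ρ r³/512)`, whose every exact reweighting
step has `log E[w_i²] = Δ²ψ(β_i; δ_i) ≤ t₀`, satisfies **`(v_ρ·#plaq/2)·(β_k − β_0)² ≤ k²·t₀`**: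
at least `(β_k − β_0)·√(v_ρ·#plaq/(2t₀))` steps — `√volume` many `O(1)`-windows. [ours] -/
theorem wilson_window_steps_necessary_strongCoupling (hρ : Continuous ρ)
    (hρu : ∀ g, ρ g ∈ Matrix.unitaryGroup (Fin N) ℂ) (hL : 2 ≤ L) (k : ℕ) (β δ : ℕ → ℝ)
    (hstep : ∀ i, β (i + 1) = β i + δ i) (hδ : ∀ i < k, 0 ≤ δ i) {D t₀ : ℝ} (hD : ∀ i < k, δ i ≤ D)
    (hlo : -(min (1 / (4 * Real.exp 1 * max 1 (2 * (N : ℝ)) * ((3 : ℝ) ^ d * (d : ℝ) ^ 2 + 1) ^ 2) / 8)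
      (variance (fun g => (ρ g).trace.re) (haarProbability G) *
        (1 / (4 * Real.exp 1 * max 1 (2 * (N : ℝ)) * ((3 : ℝ) ^ d * (d : ℝ) ^ 2 + 1) ^ 2)) ^ 3 / 512)) ≤ β 0)
    (hhi : β k + D ≤
      min (1 / (4 * Real.exp 1 * max 1 (2 * (N : ℝ)) * ((3 : ℝ) ^ d * (d : ℝ) ^ 2 + 1) ^ 2) / 8)
      (variance (fun g => (ρ g).trace.re) (haarProbability G) *
        (1 / (4 * Real.exp 1 * max 1 (2 * (N : ℝ)) * ((3 : ℝ) ^ d * (d : ℝ) ^ 2 + 1) ^ 2)) ^ 3 / 512))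
    (hcost : ∀ i < k,
      cgf (fun U => -wilsonAction ρ U) (trivialMeasure G d L) (β i + 2 * δ i) -
        2 * cgf (fun U => -wilsonAction ρ U) (trivialMeasure G d L) (β i + δ i) +
        cgf (fun U => -wilsonAction ρ U) (trivialMeasure G d L) (β i) ≤ t₀) :
    variance (fun g => (ρ g).trace.re) (haarProbability G) * Fintype.card (Plaquette d L) / 2 *
        (β k - β 0) ^ 2 ≤ (k : ℝ) ^ 2 * t₀ := by
  have hm0 : 0 ≤ variance (fun g => (ρ g).trace.re) (haarProbability G) *
      Fintype.card (Plaquette d L) / 2 := by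
    have : 0 ≤ variance (fun g => (ρ g).trace.re) (haarProbability G) := variance_nonneg _ _
    positivity
  refine window_steps_necessary (d := d) (L := L) ρ hρ k β δ hstep hδ hD hm0 (fun u hu => ?_) hcost
  refine wilson_variance_ge_half_anyGroup ρ hρ hρu hL u ?_
  rw [abs_le]
  exact ⟨by linarith [hu.1], by linarith [hu.2]⟩

/-- **SUFFICIENCY AT STRONG COUPLING, EVERY COMPACT GAUGE GROUP**: the uniform schedule
`β_j = a + jδ` (`δ ≥ 0`, `[a, a+(k+1)δ] ⊆ [−r/4, r/4]`) with **`δ²·(32·#plaq/r²) ≤ t₀`** has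
`log E[w_j²] = Δ²ψ(β_j; δ) ≤ t₀` at EVERY step: steps of size `r·√(t₀/(32·#plaq))` are admissible, so
`⌈(b − a)·√(32·#plaq/t₀)/r⌉` uniform steps cross `[a, b]` within the per-step budget —
`√volume` many `O(1)`-windows suffice. [ours] -/
theorem wilson_uniform_window_sufficient_strongCoupling (hρ : Continuous ρ)
    (hρu : ∀ g, ρ g ∈ Matrix.unitaryGroup (Fin N) ℂ) {a δ t₀ : ℝ} (hδ : 0 ≤ δ) {k : ℕ}
    (hlo : -(1 / (4 * Real.exp 1 * max 1 (2 * (N : ℝ)) * ((3 : ℝ) ^ d * (d : ℝ) ^ 2 + 1) ^ 2) / 4) ≤ a)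
    (hhi : a + (k + 1) * δ ≤
      1 / (4 * Real.exp 1 * max 1 (2 * (N : ℝ)) * ((3 : ℝ) ^ d * (d : ℝ) ^ 2 + 1) ^ 2) / 4)
    (hδM : δ ^ 2 * (32 * Fintype.card (Plaquette d L) /
      (1 / (4 * Real.exp 1 * max 1 (2 * (N : ℝ)) * ((3 : ℝ) ^ d * (d : ℝ) ^ 2 + 1) ^ 2)) ^ 2) ≤ t₀) :
    ∀ j < k,
      cgf (fun U => -wilsonAction ρ U) (trivialMeasure G d L) (a + j * δ + 2 * δ) -
        2 * cgf (fun U => -wilsonAction ρ U) (trivialMeasure G d L) (a + j * δ + δ) +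
        cgf (fun U => -wilsonAction ρ U) (trivialMeasure G d L) (a + j * δ) ≤ t₀ := by
  have hr0 := kpRadiusGroup_pos d N
  refine uniform_window_sufficient (d := d) (L := L) ρ hρ hδ (fun u hu => ?_) hδM
  refine wilson_variance_le_anyGroup (d := d) (L := L) ρ hρ hρu u ?_
  rw [abs_lt]
  exact ⟨by linarith [hu.1], by linarith [hu.2]⟩

end StrongCoupling

end Summit.Ventures.LatticeQCDFlow.TrivializingMaps

end
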